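import Literature.AlgebraicGeometry.HodgeTheory.DivisorLefschetzGroupCentreFinite
import Literature.AlgebraicGeometry.HodgeTheory.WeilClassesFieldTypeFourIsogenousPowersEndLevel
import Literature.AlgebraicGeometry.ComplexMultiplication.FieldOfDegreeTwoDimIsotypic
import HarnessLib

/-!
# Moonen–Zarhin's Lemma (1), second sentence, IN THE PRINT'S STANDING GENERALITY «`X` isogenous to `Y^m`», from
# `End(Y)`-level data: the centre `Z(G_div(X))(ℂ)` only depends on `X` up to isogeny and not on `λ`; for `X ∼ A^m`
# it is the torus `(ℂ^×)^{e₀}` when the centre `E = ℚ(ψ)` of `End⁰(A)` is CM and `d ≥ 2` or `m ≥ 2`, and a finite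
# elementary abelian `2`-group when `ψ` is Rosati-symmetric (Moonen–Zarhin 1998 §1, on `H¹(X(ℂ); ℂ)`)

Layer `Literature/AlgebraicGeometry/HodgeTheory`; THEOREMS ONLY — no definition, no named fact, no `sorry` (D-0026, net
debt 0).  Assembly of the seat's `DivisorLefschetzGroupCentreTorus` (generation 26, g26-#5: «a torus of rank `e₀`» on
`ℂ`-points from `End(X)`-level data — `ψ` central with CM minimal field, a non-commuting pair in `End(X)`),
`DivisorLefschetzGroupCentreFinite` (g26-#6: «in all other cases it is finite» from `End(X)`-level data — `ψ` central
and Rosati-symmetric, `B ⊗ ℂ = End⁰(X) ⊗ ℂ`), `WeilClassesFieldTypeFourPowersEndLevel` (g26-#2: the diagonal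
`End(A) → End(A^{n+1})` and THE CENTRE OF `M_{n+1}(End A)` IS THE DIAGONAL CENTRE), with the seat's
`DivisorLefschetzGroupIsogeny` (g15: `G_div(X')(h')(ℂ) ≅ G_div(X)(f^* h')(ℂ)` along an isogeny,
`divisorLefschetzGroup_map_isogenyConj`; «`m ≥ 2 ⟹ B = Mat_m(D)`» up to isogeny,
`pullbackOne_mem_adjoin_symmetricPullbackSpan_of_isIsogenous_powSucc`), `DivisorLefschetzGroupLargest` («`G_div(X)`
does not depend on `λ`», `divisorLefschetzGroup_eq_of_mem_hodgeClassSpan`) and the lane's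
`ComplexMultiplication.isIsogenous_biproduct_powSucc` (`⨁_{Fin (n+1)} A ∼ A^{n+1}`).  The two `End(X)`-level
theorems of generation 26 were stated ON `X`; the print's situation is «`X` isogenous to `Y^m`» with the data living on
`Y`.  This file performs the print's own two reductions — «everything only depends on `X` up to isogeny» and «`G_div(X)`
does not depend on the choice of `λ` … we may therefore assume that `λ` is the product polarization `μ^m` on
`X = Y^m`» — for the CENTRE of `G_div`, and reads both halves of Lemma (1)'s second sentence for every `X` isogenous
to a power `A^m` and every admissible polarization class on `X`, from data on `End(A)` alone.

## The print

B. J. J. Moonen, Yu. G. Zarhin, *Weil classes on abelian varieties*, J. reine angew. Math. **496** (1998) 83–92 =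
arXiv:alg-geom/9612017 [MoonenZarhin1998WeilClasses], §1 (held text `paper:arxiv-alg-geom_9612017`), VERBATIM.
Chunk p0002 L45–L48: «Since everything only depends on `X` up to isogeny, we may even assume that `X = Y^m` for some
`m ≥ 1`, where `Y` is simple. Let `D = End⁰(Y)`, let `E` be the center of `D`, and let `E₀` be the maximal totally
real subfield of `E`. We write `e₀ = [E₀:ℚ]`, `e = [E:ℚ]`, `d² = dim_E(D)`»; L83–L85: «The group `G_div(X)` does not
depend on the choice of `λ`. Without loss of generality we may therefore assume that there is a polarization `μ` on
`Y` such that `λ` is the product polarization `μ^m` on `X = Y^m`.»; L96–L97: «if `m ≥ 2` or if `X` is of type 1 or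
2, then we simply have `Δ = D`»; L121–L127, Lemma: «(1) The center of `G_div(X)` is the group `U_{K_B}` given by
`U_{K_B}(R) = {a ∈ (K_B ⊗_ℚ R)^* ∣ a a† = 1}`. For `X` of type 4 with either `d ≥ 2` or `m ≥ 2` this is a connected
torus of rank `e₀`; in all other cases it is finite.»; chunk p0003 L8–L10: «Proof. To prove this, we can first
extend scalars to `ℂ`, and (1) and (2) then readily follow from Table 2.»
J. S. Milne, *Lefschetz classes on abelian varieties*, Duke Math. J. **96** (1999) [Milne1999LefschetzClasses], §1
p. 643 («An isogeny `α : A → B` defines an isomorphism `γ ↦ V(α) ∘ γ ∘ V(α)⁻¹`»; «the diagonal action of `C(A)` on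
`rV(A)` identifies `C(A)` with `C(A^r)`»), p. 644 («Clearly `S(A)` depends only on the isogeny class of `A`»).

## Dictionary

`A` a complex abelian variety of positive dimension with `h ∈ B¹(A) ⊗ ℂ`, `h^{dim A} ≠ 0`, `Q_h` non-degenerate on
`H¹(A(ℂ); ℂ)`; `ψ ∈ End(A)` central with `R(ψ) = 0`, `R ∈ ℤ[T]` irreducible over `ℚ` (`E = ℚ(ψ)`, `[E:ℚ] = deg R`),
«`Z(End⁰ A) = E`» = every central `g ∈ End(A)` has `N g ∈ ℤ[ψ]` for some `N ≠ 0`; TYPE 4 (CM centre) = a Rosati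
image `ψ'` (`Q_h(ψ^* x, y) = Q_h(x, ψ'^* y)`) with `N'ψ' ∈ ℤ[ψ]` and `ψ' ≠ ψ`; TOTALLY REAL CENTRE («all other cases»)
= `ψ` Rosati-symmetric; «`d ≥ 2`» = a non-commuting pair `α ≫ β ≠ β ≫ α` in `End(A)`; «`m ≥ 2`» = the power
`A^{n+2} = ⨁_{Fin (n+2)} A`; `X ∼ A^m` = `AbelianVariety.IsIsogenous X (⨁_{Fin m} A)`; an admissible class on `X` =
`h_X ∈ hodgeClassSpan` with `Q_{h_X}` non-degenerate; `Z(G_div(X)(h_X))(ℂ) = Subgroup.center (divisorLefschetzGroup X h_X)`.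

## What is proved

* §1 «EVERYTHING ONLY DEPENDS ON `X` UP TO ISOGENY» and «`G_div(X)` DOES NOT DEPEND ON `λ`», for the centre:
  `nonempty_center_divisorLefschetzGroup_mulEquiv_center_map` (`Z(G_div(X')(h')) ≃* Z(G_div(X)(f^* h'))` along an
  isogeny `f : X ⟶ X'`), **`nonempty_center_divisorLefschetzGroup_mulEquiv_center_of_isIsogeny`** /
  `…_of_isIsogenous` (for admissible classes `h_X`, `h_{X'}` on isogenous `X`, `X'`: `Z(G_div(X)(h_X))(ℂ) ≃*
  Z(G_div(X')(h_{X'}))(ℂ)`), and the two shapes of Lemma (1)'s conclusion travelling along it: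
  `exists_nonempty_center_divisorLefschetzGroup_mulEquiv_pi_units_of_isIsogenous` (torus `(ℂ^×)^{e₀}`),
  `center_divisorLefschetzGroup_involutive_finite_card_le_of_isIsogenous` (involutions, finite, `card ≤ N`).
* §2 the non-commuting pairs: `biproduct_π_ι_comp_ne` (the matrix units `π₀ ≫ ι₁`, `π₁ ≫ ι₀` of `End(A^{n+2})`,
  «`m ≥ 2`»), `biproductMap_const_comp_ne_of_comp_ne` (`⊕α`, `⊕β` for a non-commuting pair in `End(A)`, «`d ≥ 2`»).
* §3 THE TORUS HALF ON THE POWERS AND UP TO ISOGENY, from `End(A)`-level CM-centre data: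
  `exists_nonempty_center_divisorLefschetzGroup_biproduct_mulEquiv_pi_units_of_CMCentre_End_of_comp_ne` (on
  `A^{n+1}` with the product class, given any non-commuting pair in `End(A^{n+1})`),
  **`exists_nonempty_center_divisorLefschetzGroup_mulEquiv_pi_units_of_isIsogenous_biproduct_two_of_CMCentre_End`**
  («`m ≥ 2`»: every `X ∼ A^{n+2}`, every admissible `h_X`: `∃ e₀, 2 e₀ = deg R ∧ Z(G_div(X)(h_X))(ℂ) ≃* (ℂ^×)^{e₀}`),
  **`exists_nonempty_center_divisorLefschetzGroup_mulEquiv_pi_units_of_isIsogenous_biproduct_of_CMCentre_End_of_comp_ne`**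
  («`d ≥ 2`», any `m ≥ 1`: the same for `X ∼ A^{n+1}` given a non-commuting pair in `End(A)`), and the
  `infinite_center_…` forms.
* §4 THE FINITE HALF ON THE POWERS AND UP TO ISOGENY, from `End(A)`-level totally-real-centre data (`ψ`
  Rosati-symmetric with `Z(End⁰ A) ⊆ ℚ(ψ)`; NO hypothesis on `B(A)`: for `m ≥ 2`, `B(A^m) ⊗ ℂ = End⁰(A^m) ⊗ ℂ` always):
  `center_divisorLefschetzGroup_biproduct_two_involutive_finite_card_le_of_symm` (on `A^{n+2}` with the product class),
  **`center_divisorLefschetzGroup_involutive_finite_card_le_of_isIsogenous_biproduct_two_of_symm`** (every `X ∼ A^{n+2}`,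
  every admissible `h_X`: all central elements are involutions, the centre is finite of order `≤ 2^{deg R}`).
* §5 THE DICHOTOMY FOR `m ≥ 2` READ ON `End(A)`:
  **`infinite_center_divisorLefschetzGroup_iff_ne_of_isIsogenous_biproduct_two`** — for `X ∼ A^{n+2}` with
  `Z(End⁰ A) = ℚ(ψ)` and Rosati image `ψ'` of `ψ` in `E`: `Z(G_div(X)(h_X))(ℂ)` is infinite iff `ψ' ≠ ψ` (type 4),
  finite iff `ψ' = ψ` (totally real centre).

## Scope (honest column)

`ℂ`-points only, as in the two parent files («connected», «torus» and «rank» as statements about algebraic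
`ℚ`-groups are not formalised: what travels is the abstract group `Z(G_div(X)(h_X))(ℂ)`).  «Type 4» / «all other
cases» are the stated hypotheses on the centre `ℚ(ψ)` of `End⁰(A)` (CM: `ψ' ≠ ψ`; totally real: `ψ' = ψ`), not the
Albert classification; simplicity of `A` is not used; `d` enters only as «a non-commuting pair in `End(A)`».  The case
`m = 1` of the finite half is the parent file's three `End(X)`-level theorems carried by §1 (no new statement here).

## References

* [MoonenZarhin1998WeilClasses] B. J. J. Moonen, Yu. G. Zarhin, Weil classes on abelian varieties, J. reine angew.
  Math. 496 (1998) 83–92; arXiv:alg-geom/9612017: §1 (chunk p0002 L45–L48, L83–L85, L96–L97), Lemma (1) (chunk p0002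
  L121–L127), proof (chunk p0003 L8–L10).
* [Milne1999LefschetzClasses] J. S. Milne, Lefschetz classes on abelian varieties, Duke Math. J. 96 (1999) 639–675, §1
  pp. 643–644, §2 pp. 645–651.
* [LangeBirkenhake1992] H. Lange, Ch. Birkenhake, Complex Abelian Varieties, Grundlehren 302 (1992), §1.1, §5.1, §5.3.
* [MumfordAV1970] D. Mumford, Abelian Varieties (1970), §19 (Hom(C, A × B) = Hom(C, A) ⊕ Hom(C, B); Remark p. 169).

## Provenance

Lane `lit-hodgefound` (Track 2, Layer A), prover seat `lit-hodgefound-p21` (generation 27), row g27-#1 — successor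
note (b) of generation 26 («Lemma (1) torus/finite for `X ∼ A^{n+1}` from `A`-level data»).
-/

noncomputable section

open CategoryTheory CategoryTheory.Limits Polynomial Module
open Literature.AlgebraicTopology.SingularHomology
open Literature.AlgebraicGeometry.Motives
open Literature.AlgebraicGeometry.VanGeemen1994 (hodgeClassSpan pullbackOne)
open Literature.AlgebraicGeometry.Milne1999
open Literature.Geometry.Kaehler (lefschetzPow)

namespace Literature.AlgebraicGeometry.HodgeTheory

/-! ### §1 The centre of `G_div` along an isogeny and across polarization classes -/

section Transport

variable {X X' : AbelianVariety ℂ} {f : X ⟶ X'} {hX : complexBetti X.X 2} {hX' : complexBetti X'.X 2}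

/-- Non-degeneracy of `Q_{h'}` on `H¹(X')` passes to `Q_{f^* h'}` on `H¹(X)` along an isogeny `f : X ⟶ X'` (`f^*` is
bijective on `H¹` and injective in every degree; cf. the lane's `polarization_hypotheses_map`, which also carries
`h'^{dim} ≠ 0`). [cite: Milne1999LefschetzClasses, §1 p. 644] -/
private theorem nondegenerate_map_of_isIsogeny (hf : AbelianVariety.IsIsogeny f)
    (hnd : ∀ x : complexBetti X'.X 1, (∀ y, polarizationPairingOne X'.X hX' (X'.dim - 1) x y = 0) → x = 0) :
    ∀ x : complexBetti X.X 1, (∀ y, polarizationPairingOne X.X (complexBetti.map f.hom.hom.hom 2 hX')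
      (X.dim - 1) x y = 0) → x = 0 := by
  rw [AbelianVariety.dim_eq_of_isIsogeny hf]
  intro x hx
  obtain ⟨x', rfl⟩ := (isogenyPullbackOne hf).surjective x
  rw [isogenyPullbackOne_apply]
  have hx' : x' = 0 := hnd x' fun y' => by
    apply (complexBetti_map_bijective_of_isIsogeny hf (2 + 2 * (X'.dim - 1))).1
    rw [map_zero, map_polarizationPairingOne]
    exact hx _
  rw [hx', map_zero]

/-- **`Z(G_div(X')(h'))(ℂ) ≅ Z(G_div(X)(f^* h'))(ℂ)` along an isogeny `f : X ⟶ X'`**: Milne's transport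
`U ↦ f^* ∘ U ∘ (f^*)⁻¹` carries `G_div(X')(h')(ℂ)` onto `G_div(X)(f^* h')(ℂ)` (the seat's
`divisorLefschetzGroup_map_isogenyConj`), hence centre onto centre.
[cite: MoonenZarhin1998WeilClasses, §1 (chunk p0002 L45–L46 «everything only depends on X up to isogeny»)]
[cite: Milne1999LefschetzClasses, §1 p. 643 («γ ↦ V(α) ∘ γ ∘ V(α)⁻¹») and p. 644] -/
theorem nonempty_center_divisorLefschetzGroup_mulEquiv_center_map (hf : AbelianVariety.IsIsogeny f)
    (hX' : complexBetti X'.X 2) :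
    Nonempty (Subgroup.center (divisorLefschetzGroup X' hX') ≃*
      Subgroup.center (divisorLefschetzGroup X (complexBetti.map f.hom.hom.hom 2 hX'))) :=
  ⟨Subgroup.centerCongr (((isogenyConj hf).subgroupMap (divisorLefschetzGroup X' hX')).trans
    (MulEquiv.subgroupCongr (divisorLefschetzGroup_map_isogenyConj hf hX')))⟩

/-- **THE CENTRE OF `G_div` ONLY DEPENDS ON `X` UP TO ISOGENY, AND NOT ON `λ`**: for an isogeny `f : X ⟶ X'` and
admissible classes `h_X` on `X`, `h_{X'}` on `X'` (in `B¹ ⊗ ℂ`, non-degenerate pairing), `Z(G_div(X)(h_X))(ℂ) ≃*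
Z(G_div(X')(h_{X'}))(ℂ)` — through `G_div(X)(h_X) = G_div(X)(f^* h_{X'})` («`G_div(X)` does not depend on the
choice of `λ`», the seat's `divisorLefschetzGroup_eq_of_mem_hodgeClassSpan`) and the transport along `f`.
[cite: MoonenZarhin1998WeilClasses, §1 (chunk p0002 L45–L46 and L83 «The group G_div(X) does not depend on the choice of λ»)]
[cite: Milne1999LefschetzClasses, §1 pp. 643–644] -/
theorem nonempty_center_divisorLefschetzGroup_mulEquiv_center_of_isIsogeny (hf : AbelianVariety.IsIsogeny f)
    (hhX : hX ∈ hodgeClassSpan X.dim X.X 1)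
    (hndX : ∀ x : complexBetti X.X 1, (∀ y, polarizationPairingOne X.X hX (X.dim - 1) x y = 0) → x = 0)
    (hhX' : hX' ∈ hodgeClassSpan X'.dim X'.X 1)
    (hndX' : ∀ x : complexBetti X'.X 1, (∀ y, polarizationPairingOne X'.X hX' (X'.dim - 1) x y = 0) → x = 0) :
    Nonempty (Subgroup.center (divisorLefschetzGroup X hX) ≃* Subgroup.center (divisorLefschetzGroup X' hX')) := by
  obtain ⟨e⟩ := nonempty_center_divisorLefschetzGroup_mulEquiv_center_map hf hX'
  have heq : divisorLefschetzGroup X (complexBetti.map f.hom.hom.hom 2 hX') = divisorLefschetzGroup X hX :=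
    divisorLefschetzGroup_eq_of_mem_hodgeClassSpan (map_mem_hodgeClassSpan_one f hhX')
      (nondegenerate_map_of_isIsogeny hf hndX') hhX hndX
  exact ⟨(e.trans (Subgroup.centerCongr (MulEquiv.subgroupCongr heq))).symm⟩

/-- **… for isogenous `X ∼ X'`** (`AbelianVariety.IsIsogenous X X'`; the relation is symmetric, the tree's
`IsIsogenous.symm'`). [cite: MoonenZarhin1998WeilClasses, §1 (chunk p0002 L45–L46, L83)]
[cite: Milne1999LefschetzClasses, §1 pp. 643–644] -/
theorem nonempty_center_divisorLefschetzGroup_mulEquiv_center_of_isIsogenous (hXX' : AbelianVariety.IsIsogenous X X')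
    (hhX : hX ∈ hodgeClassSpan X.dim X.X 1)
    (hndX : ∀ x : complexBetti X.X 1, (∀ y, polarizationPairingOne X.X hX (X.dim - 1) x y = 0) → x = 0)
    (hhX' : hX' ∈ hodgeClassSpan X'.dim X'.X 1)
    (hndX' : ∀ x : complexBetti X'.X 1, (∀ y, polarizationPairingOne X'.X hX' (X'.dim - 1) x y = 0) → x = 0) :
    Nonempty (Subgroup.center (divisorLefschetzGroup X hX) ≃* Subgroup.center (divisorLefschetzGroup X' hX')) := by
  obtain ⟨f, hf⟩ := hXX'
  exact nonempty_center_divisorLefschetzGroup_mulEquiv_center_of_isIsogeny hf hhX hndX hhX' hndX'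

/-- **Lemma (1)'s «torus of rank `e₀`» travels along isogenies**: if `Z(G_div(X')(h_{X'}))(ℂ) ≃* (ℂ^×)^{e₀}` with
`2 e₀ = e`, then the same holds for every `X ∼ X'` and every admissible `h_X`.
[cite: MoonenZarhin1998WeilClasses, §1 (chunk p0002 L45–L46, L83) and Lemma (1) (chunk p0002 L121–L127)] -/
theorem exists_nonempty_center_divisorLefschetzGroup_mulEquiv_pi_units_of_isIsogenous
    (hXX' : AbelianVariety.IsIsogenous X X') (hhX : hX ∈ hodgeClassSpan X.dim X.X 1)
    (hndX : ∀ x : complexBetti X.X 1, (∀ y, polarizationPairingOne X.X hX (X.dim - 1) x y = 0) → x = 0)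
    (hhX' : hX' ∈ hodgeClassSpan X'.dim X'.X 1)
    (hndX' : ∀ x : complexBetti X'.X 1, (∀ y, polarizationPairingOne X'.X hX' (X'.dim - 1) x y = 0) → x = 0)
    {e : ℕ} (H : ∃ e₀ : ℕ, 2 * e₀ = e ∧ Nonempty (Subgroup.center (divisorLefschetzGroup X' hX') ≃* (Fin e₀ → ℂˣ))) :
    ∃ e₀ : ℕ, 2 * e₀ = e ∧ Nonempty (Subgroup.center (divisorLefschetzGroup X hX) ≃* (Fin e₀ → ℂˣ)) := by
  obtain ⟨e₀, he, ⟨Ψ⟩⟩ := H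
  obtain ⟨Φ⟩ := nonempty_center_divisorLefschetzGroup_mulEquiv_center_of_isIsogenous hXX' hhX hndX hhX' hndX'
  exact ⟨e₀, he, ⟨Φ.trans Ψ⟩⟩

/-- **Lemma (1)'s «finite» travels along isogenies**: if every central element of `G_div(X')(h_{X'})(ℂ)` is an
involution and the centre is finite of order `≤ N`, then the same holds for every `X ∼ X'` and every admissible `h_X`.
[cite: MoonenZarhin1998WeilClasses, §1 (chunk p0002 L45–L46, L83) and Lemma (1) (chunk p0002 L121–L127)] -/
theorem center_divisorLefschetzGroup_involutive_finite_card_le_of_isIsogenous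
    (hXX' : AbelianVariety.IsIsogenous X X') (hhX : hX ∈ hodgeClassSpan X.dim X.X 1)
    (hndX : ∀ x : complexBetti X.X 1, (∀ y, polarizationPairingOne X.X hX (X.dim - 1) x y = 0) → x = 0)
    (hhX' : hX' ∈ hodgeClassSpan X'.dim X'.X 1)
    (hndX' : ∀ x : complexBetti X'.X 1, (∀ y, polarizationPairingOne X'.X hX' (X'.dim - 1) x y = 0) → x = 0)
    {N : ℕ} (H : (∀ z ∈ Subgroup.center (divisorLefschetzGroup X' hX'), z * z = 1) ∧
      Finite (Subgroup.center (divisorLefschetzGroup X' hX')) ∧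
      Nat.card (Subgroup.center (divisorLefschetzGroup X' hX')) ≤ N) :
    (∀ z ∈ Subgroup.center (divisorLefschetzGroup X hX), z * z = 1) ∧
      Finite (Subgroup.center (divisorLefschetzGroup X hX)) ∧
      Nat.card (Subgroup.center (divisorLefschetzGroup X hX)) ≤ N := by
  obtain ⟨hinv, hfin, hcard⟩ := H
  obtain ⟨Φ⟩ := nonempty_center_divisorLefschetzGroup_mulEquiv_center_of_isIsogenous hXX' hhX hndX hhX' hndX'
  refine ⟨fun z hz ↦ ?_, Finite.of_equiv _ Φ.symm.toEquiv, ?_⟩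
  · have e := hinv (Φ ⟨z, hz⟩ : divisorLefschetzGroup X' hX') (Φ ⟨z, hz⟩).2
    rw [← Subgroup.coe_mul, ← map_mul, ← Subgroup.coe_one (Subgroup.center (divisorLefschetzGroup X' hX')),
      Subtype.coe_inj, map_eq_one_iff Φ Φ.injective] at e
    exact congrArg Subtype.val e
  · rw [Nat.card_congr Φ.toEquiv]
    exact hcard

end Transport

/-! ### §2 Non-commuting pairs in `End(A^{n+2})` («`m ≥ 2`») and in `End(A^{n+1})` from `End(A)` («`d ≥ 2`») -/

section NonComm

variable {A : AbelianVariety ℂ} {n : ℕ}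

/-- `𝟙_A ≠ 0` for an abelian variety of positive dimension (`H¹(A(ℂ); ℂ)` has dimension `2 dim A > 0` and pull-back
is functorial). [cite: LangeBirkenhake1992, §1.1 (the rational representation is faithful)] -/
private theorem id_ne_zero (hA : 0 < A.dim) : (𝟙 A : A ⟶ A) ≠ 0 := by
  intro e
  haveI : Module.Finite ℂ (complexBetti A.X 1) := abelianVarietyCohomologyExteriorH1_holds.finite_one A
  have h1 : (1 : Module.End ℂ (complexBetti A.X 1)) = 0 := by
    rw [← pullbackOne_id_eq_one, e, pullbackOne_zero_eq_zero]
  have hV : 0 < Module.finrank ℂ (complexBetti A.X 1) := by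
    rw [AbelianVariety.finrank_complexBetti_one]; omega
  obtain ⟨x, hx⟩ := Module.finrank_pos_iff_exists_ne_zero.1 hV
  have ex := LinearMap.congr_fun h1 x
  rw [Module.End.one_apply, LinearMap.zero_apply] at ex
  exact hx ex

/-- **«`m ≥ 2`»: the matrix units `π₀ ≫ ι₁` and `π₁ ≫ ι₀` of `End(A^{n+2}) = M_{n+2}(End A)` do not commute**
(`E₁₀ E₀₁ = E₁₁ ≠ E₀₀ = E₀₁ E₁₀` in the print's `Mat_m(D)`, `0 < dim A`).
[cite: MoonenZarhin1998WeilClasses, §1 (chunk p0002 L87–L90 «End⁰(X) = Mat_m(D)»)] [cite: LangeBirkenhake1992, §5.3] -/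
theorem biproduct_π_ι_comp_ne (hA : 0 < A.dim) :
    (biproduct.π (fun _ : Fin (n + 2) => A) 0 ≫ biproduct.ι (fun _ : Fin (n + 2) => A) 1) ≫
        (biproduct.π (fun _ : Fin (n + 2) => A) 1 ≫ biproduct.ι (fun _ : Fin (n + 2) => A) 0) ≠
      (biproduct.π (fun _ : Fin (n + 2) => A) 1 ≫ biproduct.ι (fun _ : Fin (n + 2) => A) 0) ≫
        (biproduct.π (fun _ : Fin (n + 2) => A) 0 ≫ biproduct.ι (fun _ : Fin (n + 2) => A) 1) := by
  intro e
  have h01 : (0 : Fin (n + 2)) ≠ 1 := Fin.zero_ne_one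
  have e' := congrArg
    (fun Χ ↦ biproduct.ι (fun _ : Fin (n + 2) => A) 0 ≫ Χ ≫ biproduct.π (fun _ : Fin (n + 2) => A) 0) e
  simp only [Category.assoc, biproduct.ι_π_self, biproduct.ι_π_self_assoc, Category.comp_id,
    biproduct.ι_π_ne_assoc _ h01, Limits.zero_comp] at e'
  exact id_ne_zero hA e'

/-- **«`d ≥ 2`»: a non-commuting pair `α ≫ β ≠ β ≫ α` in `End(A)` gives the non-commuting pair `⊕α`, `⊕β` in
`End(A^{n+1})`** (the diagonal `End(A) → End(A^{n+1})` is an injective ring homomorphism).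
[cite: Milne1999LefschetzClasses, §1 p. 643 («the diagonal action of C(A) on rV(A) identifies C(A) with C(A^r)»)] [cite: LangeBirkenhake1992, §1.1, §5.3] -/
theorem biproductMap_const_comp_ne_of_comp_ne {α β : A ⟶ A} (hαβ : α ≫ β ≠ β ≫ α) :
    (biproduct.map fun _ : Fin (n + 1) => α) ≫ (biproduct.map fun _ : Fin (n + 1) => β) ≠
      (biproduct.map fun _ : Fin (n + 1) => β) ≫ (biproduct.map fun _ : Fin (n + 1) => α) := by
  intro e
  apply hαβ
  have e' := congrArg
    (fun Χ ↦ biproduct.ι (fun _ : Fin (n + 1) => A) 0 ≫ Χ ≫ biproduct.π (fun _ : Fin (n + 1) => A) 0) e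
  simpa only [Category.assoc, biproduct.map_π, biproduct.map_π_assoc, biproduct.ι_π_self_assoc] using e'

end NonComm

/-! ### §3 The torus half: «for `X` of type 4 with either `d ≥ 2` or `m ≥ 2` this is a connected torus of rank `e₀`» — on the powers `A^{n+1}` and for every `X` isogenous to them, from `End(A)`-level CM-centre data -/

section Torus

open CentralTorus

variable {A : AbelianVariety ℂ} {h : complexBetti A.X 2} {n : ℕ} {ψ ψ' : A ⟶ A} {R : Polynomial ℤ}

/-- **THE TORUS ON THE POWER `A^{n+1}` WITH THE PRODUCT POLARIZATION, from `End(A)`-level data and a non-commuting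
pair in `End(A^{n+1})`.**  `A` of positive dimension with `h ∈ B¹(A) ⊗ ℂ`, `h^{dim A} ≠ 0`, `Q_h` non-degenerate; the
centre of `End⁰(A)` is the CM field `E = ℚ(ψ)` (`ψ` central, `R(ψ) = 0` with `R` monic irreducible over `ℚ`, Rosati
image `ψ'` with `N'ψ' ∈ ℤ[ψ]`, `ψ' ≠ ψ`, every central `g` with `N g ∈ ℤ[ψ]`).  On `X = A^{n+1}` the diagonal `⊕ψ` is
central with the same minimal polynomial, Rosati image `⊕ψ'` for `Σ πᵢ^* h`, and `Z(End(A^{n+1})) = ⊕Z(End(A))`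
(the seat's `WeilClassesFieldTypeFourPowersEndLevel` §1); so for any non-commuting `α ≫ β ≠ β ≫ α` in `End(A^{n+1})`
the seat's `exists_nonempty_center_divisorLefschetzGroup_mulEquiv_pi_units_of_CMCentre_End_of_ne` applies ON `A^{n+1}`:
`∃ e₀, 2 e₀ = deg R ∧ Z(G_div(A^{n+1})(Σ πᵢ^* h))(ℂ) ≃* (ℂ^×)^{e₀}`.
[cite: MoonenZarhin1998WeilClasses, §1 Lemma (1) (chunk p0002 L121–L127 «For X of type 4 with either d ≥ 2 or m ≥ 2 this is a connected torus of rank e₀») with chunk p0002 L83–L85 («λ is the product polarization μ^m on X = Y^m»)]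
[cite: Milne1999LefschetzClasses, §1 p. 643 («the diagonal action of C(A) on rV(A) identifies C(A) with C(A^r)»), §2 pp. 645–651] -/
theorem exists_nonempty_center_divisorLefschetzGroup_biproduct_mulEquiv_pi_units_of_CMCentre_End_of_comp_ne
    (hA : 0 < A.dim) (hh : h ∈ hodgeClassSpan A.dim A.X 1) (htop : lefschetzPow h (A.dim - 1) 2 h ≠ 0)
    (hnd : ∀ x : complexBetti A.X 1, (∀ y, polarizationPairingOne A.X h (A.dim - 1) x y = 0) → x = 0)
    (hψ : ∀ χ : A ⟶ A, ψ ≫ χ = χ ≫ ψ) (hRm : R.Monic) (hRirr : Irreducible (R.map (Int.castRingHom ℚ)))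
    (hψR : Polynomial.eval₂ (Int.castRingHom (CategoryTheory.End A)) (ψ : CategoryTheory.End A) R = 0)
    (hadj : ∀ x y : complexBetti A.X 1, polarizationPairingOne A.X h (A.dim - 1) (pullbackOne A ψ x) y =
      polarizationPairingOne A.X h (A.dim - 1) x (pullbackOne A ψ' y))
    (hψ'E : ∃ N : ℤ, N ≠ 0 ∧ End.of (N • ψ') ∈ Subring.closure {End.of ψ}) (hne : ψ' ≠ ψ)
    (hZ : ∀ g : A ⟶ A, (∀ χ : A ⟶ A, g ≫ χ = χ ≫ g) →
      ∃ N : ℤ, N ≠ 0 ∧ End.of (N • g) ∈ Subring.closure {End.of ψ})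
    {α β : (⨁ (fun _ : Fin (n + 1) => A)) ⟶ ⨁ (fun _ : Fin (n + 1) => A)} (hαβ : α ≫ β ≠ β ≫ α) :
    ∃ e₀ : ℕ, 2 * e₀ = R.natDegree ∧
      Nonempty (Subgroup.center (divisorLefschetzGroup (⨁ (fun _ : Fin (n + 1) => A))
        (sumPolarizationClass (fun _ : Fin (n + 1) => A) fun _ => h)) ≃* (Fin e₀ → ℂˣ)) := by
  obtain ⟨hhX, -, hndX⟩ := sumPolarizationClass_hypotheses (fun _ : Fin (n + 1) => A) (fun _ => h) (fun _ => hA)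
    (fun _ => hh) (fun _ => htop) (fun _ => hnd)
  have hadjX := fun x y ↦ polarizationPairingOne_biproductMap_of_adjoint (fun _ : Fin (n + 1) => A) (fun _ => h)
    (fun _ => hA) (fun _ => ψ) (fun _ => ψ') (fun _ => hadj) x y
  exact exists_nonempty_center_divisorLefschetzGroup_mulEquiv_pi_units_of_CMCentre_End_of_ne hhX hndX
    (biproductMap_const_comm_of_forall_comm hψ) hRm hRirr (eval₂_biproductMap_const_eq_zero hψR) hadjX
    (exists_zsmul_biproductMap_const_mem_closure hψ'E) (biproductMap_const_ne_of_ne hne)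
    (forall_central_exists_zsmul_mem_closure_biproduct hZ) hαβ

/-- **MOONEN–ZARHIN LEMMA (1), «TYPE 4 WITH `m ≥ 2` ⟹ `Z(G_div(X))` IS A TORUS OF RANK `e₀`», IN THE PRINT'S STANDING
GENERALITY, `ℂ`-POINTS**: for EVERY complex abelian variety `X` ISOGENOUS TO A POWER `A^{n+2}` of an abelian variety
whose endomorphism algebra has CM centre `E = ℚ(ψ)` (the `End(A)`-level data above) and EVERY admissible class `h_X`
on `X` (`h_X ∈ B¹(X) ⊗ ℂ`, `Q_{h_X}` non-degenerate): `∃ e₀, 2 e₀ = deg R = [E:ℚ] ∧ Z(G_div(X)(h_X))(ℂ) ≃* (ℂ^×)^{e₀}`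
— the matrix units `π₀ ≫ ι₁`, `π₁ ≫ ι₀` of `End(A^{n+2})` do not commute (§2), the torus on `A^{n+2}` with the product
class, and §1 («everything only depends on `X` up to isogeny», «`G_div(X)` does not depend on the choice of `λ`»).
No hypothesis on `d`; simplicity of `A` is not used.
[cite: MoonenZarhin1998WeilClasses, §1 Lemma (1) (chunk p0002 L121–L127) with chunk p0002 L45–L48 («we may even assume that X = Y^m … E the center of D … e₀ = [E₀:ℚ], e = [E:ℚ]») and L83–L85]
[cite: Milne1999LefschetzClasses, §1 pp. 643–644, §2 pp. 645–651] -/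
theorem exists_nonempty_center_divisorLefschetzGroup_mulEquiv_pi_units_of_isIsogenous_biproduct_two_of_CMCentre_End
    (hA : 0 < A.dim) (hh : h ∈ hodgeClassSpan A.dim A.X 1) (htop : lefschetzPow h (A.dim - 1) 2 h ≠ 0)
    (hnd : ∀ x : complexBetti A.X 1, (∀ y, polarizationPairingOne A.X h (A.dim - 1) x y = 0) → x = 0)
    (hψ : ∀ χ : A ⟶ A, ψ ≫ χ = χ ≫ ψ) (hRm : R.Monic) (hRirr : Irreducible (R.map (Int.castRingHom ℚ)))
    (hψR : Polynomial.eval₂ (Int.castRingHom (CategoryTheory.End A)) (ψ : CategoryTheory.End A) R = 0)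
    (hadj : ∀ x y : complexBetti A.X 1, polarizationPairingOne A.X h (A.dim - 1) (pullbackOne A ψ x) y =
      polarizationPairingOne A.X h (A.dim - 1) x (pullbackOne A ψ' y))
    (hψ'E : ∃ N : ℤ, N ≠ 0 ∧ End.of (N • ψ') ∈ Subring.closure {End.of ψ}) (hne : ψ' ≠ ψ)
    (hZ : ∀ g : A ⟶ A, (∀ χ : A ⟶ A, g ≫ χ = χ ≫ g) →
      ∃ N : ℤ, N ≠ 0 ∧ End.of (N • g) ∈ Subring.closure {End.of ψ})
    {X : AbelianVariety ℂ} (hX : AbelianVariety.IsIsogenous X (⨁ (fun _ : Fin (n + 2) => A)))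
    {hX' : complexBetti X.X 2} (hhX : hX' ∈ hodgeClassSpan X.dim X.X 1)
    (hndX : ∀ x : complexBetti X.X 1, (∀ y, polarizationPairingOne X.X hX' (X.dim - 1) x y = 0) → x = 0) :
    ∃ e₀ : ℕ, 2 * e₀ = R.natDegree ∧
      Nonempty (Subgroup.center (divisorLefschetzGroup X hX') ≃* (Fin e₀ → ℂˣ)) := by
  obtain ⟨hhP, -, hndP⟩ := sumPolarizationClass_hypotheses (fun _ : Fin (n + 2) => A) (fun _ => h) (fun _ => hA)
    (fun _ => hh) (fun _ => htop) (fun _ => hnd)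
  exact exists_nonempty_center_divisorLefschetzGroup_mulEquiv_pi_units_of_isIsogenous hX hhX hndX hhP hndP
    (exists_nonempty_center_divisorLefschetzGroup_biproduct_mulEquiv_pi_units_of_CMCentre_End_of_comp_ne hA hh htop
      hnd hψ hRm hRirr hψR hadj hψ'E hne hZ (biproduct_π_ι_comp_ne hA))

/-- **MOONEN–ZARHIN LEMMA (1), «TYPE 4 WITH `d ≥ 2` ⟹ `Z(G_div(X))` IS A TORUS OF RANK `e₀`», ANY `m ≥ 1`, IN THE
PRINT'S STANDING GENERALITY, `ℂ`-POINTS**: the same conclusion for every `X` isogenous to `A^{n+1}` (`n ≥ 0`) and every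
admissible `h_X`, given a non-commuting pair `α ≫ β ≠ β ≫ α` in `End(A)` («`d ≥ 2`»: `End⁰(A) ≠ E`), carried
diagonally to `End(A^{n+1})` (§2).
[cite: MoonenZarhin1998WeilClasses, §1 Lemma (1) (chunk p0002 L121–L127) with chunk p0002 L45–L48 and L83–L85]
[cite: Milne1999LefschetzClasses, §1 pp. 643–644, §2 pp. 645–651] -/
theorem exists_nonempty_center_divisorLefschetzGroup_mulEquiv_pi_units_of_isIsogenous_biproduct_of_CMCentre_End_of_comp_ne
    (hA : 0 < A.dim) (hh : h ∈ hodgeClassSpan A.dim A.X 1) (htop : lefschetzPow h (A.dim - 1) 2 h ≠ 0)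
    (hnd : ∀ x : complexBetti A.X 1, (∀ y, polarizationPairingOne A.X h (A.dim - 1) x y = 0) → x = 0)
    (hψ : ∀ χ : A ⟶ A, ψ ≫ χ = χ ≫ ψ) (hRm : R.Monic) (hRirr : Irreducible (R.map (Int.castRingHom ℚ)))
    (hψR : Polynomial.eval₂ (Int.castRingHom (CategoryTheory.End A)) (ψ : CategoryTheory.End A) R = 0)
    (hadj : ∀ x y : complexBetti A.X 1, polarizationPairingOne A.X h (A.dim - 1) (pullbackOne A ψ x) y =
      polarizationPairingOne A.X h (A.dim - 1) x (pullbackOne A ψ' y))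
    (hψ'E : ∃ N : ℤ, N ≠ 0 ∧ End.of (N • ψ') ∈ Subring.closure {End.of ψ}) (hne : ψ' ≠ ψ)
    (hZ : ∀ g : A ⟶ A, (∀ χ : A ⟶ A, g ≫ χ = χ ≫ g) →
      ∃ N : ℤ, N ≠ 0 ∧ End.of (N • g) ∈ Subring.closure {End.of ψ})
    {α β : A ⟶ A} (hαβ : α ≫ β ≠ β ≫ α)
    {X : AbelianVariety ℂ} (hX : AbelianVariety.IsIsogenous X (⨁ (fun _ : Fin (n + 1) => A)))
    {hX' : complexBetti X.X 2} (hhX : hX' ∈ hodgeClassSpan X.dim X.X 1)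
    (hndX : ∀ x : complexBetti X.X 1, (∀ y, polarizationPairingOne X.X hX' (X.dim - 1) x y = 0) → x = 0) :
    ∃ e₀ : ℕ, 2 * e₀ = R.natDegree ∧
      Nonempty (Subgroup.center (divisorLefschetzGroup X hX') ≃* (Fin e₀ → ℂˣ)) := by
  obtain ⟨hhP, -, hndP⟩ := sumPolarizationClass_hypotheses (fun _ : Fin (n + 1) => A) (fun _ => h) (fun _ => hA)
    (fun _ => hh) (fun _ => htop) (fun _ => hnd)
  exact exists_nonempty_center_divisorLefschetzGroup_mulEquiv_pi_units_of_isIsogenous hX hhX hndX hhP hndP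
    (exists_nonempty_center_divisorLefschetzGroup_biproduct_mulEquiv_pi_units_of_CMCentre_End_of_comp_ne hA hh htop
      hnd hψ hRm hRirr hψR hadj hψ'E hne hZ (biproductMap_const_comp_ne_of_comp_ne hαβ))

/-- A group isomorphic to `(ℂ^×)^{e₀}` with `2 e₀ = deg R`, `R` irreducible over `ℚ`, is infinite (`e₀ ≥ 1`). [folklore] -/
private theorem infinite_of_mulEquiv_pi_units {G : Type*} [Group G] (hRirr : Irreducible (R.map (Int.castRingHom ℚ)))
    {e₀ : ℕ} (he : 2 * e₀ = R.natDegree) (Ψ : G ≃* (Fin e₀ → ℂˣ)) : Infinite G := by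
  have hdeg : 0 < R.natDegree := by
    rw [← Polynomial.natDegree_map_eq_of_injective (RingHom.injective_int (Int.castRingHom ℚ)) R]
    exact Polynomial.natDegree_pos_iff_degree_pos.2 (Polynomial.degree_pos_of_irreducible hRirr)
  have he0 : 0 < e₀ := by omega
  haveI : Infinite ℂˣ := by
    refine Infinite.of_injective (fun k : ℕ ↦ Units.mk0 ((k : ℂ) + 1) (by exact_mod_cast Nat.succ_ne_zero k))
      fun k l e ↦ ?_
    have e' := congrArg (fun u : ℂˣ ↦ (u : ℂ)) e
    simp only [Units.val_mk0, add_left_inj, Nat.cast_inj] at e'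
    exact e'
  haveI : Infinite (Fin e₀ → ℂˣ) := Pi.infinite_of_exists_right (⟨0, he0⟩ : Fin e₀)
  exact Infinite.of_injective Ψ.symm Ψ.symm.injective

/-- **… IN PARTICULAR `Z(G_div(X)(h_X))(ℂ)` IS INFINITE for every `X ∼ A^{n+2}`** (CM centre; contrast §4).
[cite: MoonenZarhin1998WeilClasses, §1 Lemma (1) (chunk p0002 L121–L127)] -/
theorem infinite_center_divisorLefschetzGroup_of_isIsogenous_biproduct_two_of_CMCentre_End
    (hA : 0 < A.dim) (hh : h ∈ hodgeClassSpan A.dim A.X 1) (htop : lefschetzPow h (A.dim - 1) 2 h ≠ 0)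
    (hnd : ∀ x : complexBetti A.X 1, (∀ y, polarizationPairingOne A.X h (A.dim - 1) x y = 0) → x = 0)
    (hψ : ∀ χ : A ⟶ A, ψ ≫ χ = χ ≫ ψ) (hRm : R.Monic) (hRirr : Irreducible (R.map (Int.castRingHom ℚ)))
    (hψR : Polynomial.eval₂ (Int.castRingHom (CategoryTheory.End A)) (ψ : CategoryTheory.End A) R = 0)
    (hadj : ∀ x y : complexBetti A.X 1, polarizationPairingOne A.X h (A.dim - 1) (pullbackOne A ψ x) y =
      polarizationPairingOne A.X h (A.dim - 1) x (pullbackOne A ψ' y))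
    (hψ'E : ∃ N : ℤ, N ≠ 0 ∧ End.of (N • ψ') ∈ Subring.closure {End.of ψ}) (hne : ψ' ≠ ψ)
    (hZ : ∀ g : A ⟶ A, (∀ χ : A ⟶ A, g ≫ χ = χ ≫ g) →
      ∃ N : ℤ, N ≠ 0 ∧ End.of (N • g) ∈ Subring.closure {End.of ψ})
    {X : AbelianVariety ℂ} (hX : AbelianVariety.IsIsogenous X (⨁ (fun _ : Fin (n + 2) => A)))
    {hX' : complexBetti X.X 2} (hhX : hX' ∈ hodgeClassSpan X.dim X.X 1)
    (hndX : ∀ x : complexBetti X.X 1, (∀ y, polarizationPairingOne X.X hX' (X.dim - 1) x y = 0) → x = 0) :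
    Infinite (Subgroup.center (divisorLefschetzGroup X hX')) := by
  obtain ⟨e₀, he, ⟨Ψ⟩⟩ :=
    exists_nonempty_center_divisorLefschetzGroup_mulEquiv_pi_units_of_isIsogenous_biproduct_two_of_CMCentre_End hA hh
      htop hnd hψ hRm hRirr hψR hadj hψ'E hne hZ hX hhX hndX
  exact infinite_of_mulEquiv_pi_units hRirr he Ψ

/-- **… and `Z(G_div(X)(h_X))(ℂ)` IS INFINITE for every `X ∼ A^{n+1}` when `End(A)` has a non-commuting pair**
(CM centre, «`d ≥ 2`»). [cite: MoonenZarhin1998WeilClasses, §1 Lemma (1) (chunk p0002 L121–L127)] -/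
theorem infinite_center_divisorLefschetzGroup_of_isIsogenous_biproduct_of_CMCentre_End_of_comp_ne
    (hA : 0 < A.dim) (hh : h ∈ hodgeClassSpan A.dim A.X 1) (htop : lefschetzPow h (A.dim - 1) 2 h ≠ 0)
    (hnd : ∀ x : complexBetti A.X 1, (∀ y, polarizationPairingOne A.X h (A.dim - 1) x y = 0) → x = 0)
    (hψ : ∀ χ : A ⟶ A, ψ ≫ χ = χ ≫ ψ) (hRm : R.Monic) (hRirr : Irreducible (R.map (Int.castRingHom ℚ)))
    (hψR : Polynomial.eval₂ (Int.castRingHom (CategoryTheory.End A)) (ψ : CategoryTheory.End A) R = 0)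
    (hadj : ∀ x y : complexBetti A.X 1, polarizationPairingOne A.X h (A.dim - 1) (pullbackOne A ψ x) y =
      polarizationPairingOne A.X h (A.dim - 1) x (pullbackOne A ψ' y))
    (hψ'E : ∃ N : ℤ, N ≠ 0 ∧ End.of (N • ψ') ∈ Subring.closure {End.of ψ}) (hne : ψ' ≠ ψ)
    (hZ : ∀ g : A ⟶ A, (∀ χ : A ⟶ A, g ≫ χ = χ ≫ g) →
      ∃ N : ℤ, N ≠ 0 ∧ End.of (N • g) ∈ Subring.closure {End.of ψ})
    {α β : A ⟶ A} (hαβ : α ≫ β ≠ β ≫ α)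
    {X : AbelianVariety ℂ} (hX : AbelianVariety.IsIsogenous X (⨁ (fun _ : Fin (n + 1) => A)))
    {hX' : complexBetti X.X 2} (hhX : hX' ∈ hodgeClassSpan X.dim X.X 1)
    (hndX : ∀ x : complexBetti X.X 1, (∀ y, polarizationPairingOne X.X hX' (X.dim - 1) x y = 0) → x = 0) :
    Infinite (Subgroup.center (divisorLefschetzGroup X hX')) := by
  obtain ⟨e₀, he, ⟨Ψ⟩⟩ :=
    exists_nonempty_center_divisorLefschetzGroup_mulEquiv_pi_units_of_isIsogenous_biproduct_of_CMCentre_End_of_comp_ne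
      hA hh htop hnd hψ hRm hRirr hψR hadj hψ'E hne hZ hαβ hX hhX hndX
  exact infinite_of_mulEquiv_pi_units hRirr he Ψ

end Torus

/-! ### §4 The finite half: «in all other cases it is finite» — on the powers `A^{n+2}` and for every `X` isogenous to them, from `End(A)`-level totally-real-centre data -/

section FiniteHalf

open CentralTorus
open Literature.AlgebraicGeometry.ComplexMultiplication (isIsogenous_biproduct_powSucc)

variable {A : AbelianVariety ℂ} {h : complexBetti A.X 2} {n : ℕ} {ψ : A ⟶ A} {R : Polynomial ℤ}

/-- **THE FINITE CENTRE ON THE POWER `A^{n+2}` WITH THE PRODUCT POLARIZATION, from `End(A)`-level data.**  `A` of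
positive dimension with `h ∈ B¹(A) ⊗ ℂ`, `h^{dim A} ≠ 0`, `Q_h` non-degenerate; `ψ ∈ End(A)` ROSATI-SYMMETRIC
(`Q_h(ψ^* x, y) = Q_h(x, ψ^* y)` — «`†` trivial on the centre», totally real centre: types 1, 2, 3) with `R(ψ) = 0`,
`R` irreducible over `ℚ`, and `Z(End⁰ A) ⊆ ℚ(ψ)` (every central `g` with `N g ∈ ℤ[ψ]`; centrality of `ψ` itself is
not needed).  On `A^{n+2} = ⨁_{Fin (n+2)} A` with `Σ πᵢ^* h`: `⊕ψ` is Rosati-symmetric, `R(⊕ψ) = 0`,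
`Z(End(A^{n+2})) = ⊕Z(End A)` (the seat's `WeilClassesFieldTypeFourPowersEndLevel` §1), and «`m ≥ 2 ⟹ B = Mat_m(D) = End⁰(X)`»
(`B(A^{n+2}) ⊗ ℂ = End⁰(A^{n+2}) ⊗ ℂ`, the seat's `DivisorLefschetzGroupIsogeny` through `⨁_{Fin (n+2)} A ∼ A^{n+2}`);
hence the seat's `finite_center_divisorLefschetzGroup_of_forall_mem_adjoin_of_symm` ON `A^{n+2}`: every central element
of `G_div(A^{n+2})(Σ πᵢ^* h)(ℂ)` is an involution and the centre is finite of order `≤ 2^{deg R}`.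
[cite: MoonenZarhin1998WeilClasses, §1 Lemma (1) (chunk p0002 L121–L127 «in all other cases it is finite») with chunk p0002 L83–L85, L96–L97 («if m ≥ 2 … Δ = D») and chunk p0003 L107–L110 («B = Mat_m(D)»)]
[cite: Milne1999LefschetzClasses, §1 p. 643, Remark 1.2, §2 pp. 645–650] -/
theorem center_divisorLefschetzGroup_biproduct_two_involutive_finite_card_le_of_symm
    (hA : 0 < A.dim) (hh : h ∈ hodgeClassSpan A.dim A.X 1) (htop : lefschetzPow h (A.dim - 1) 2 h ≠ 0)
    (hnd : ∀ x : complexBetti A.X 1, (∀ y, polarizationPairingOne A.X h (A.dim - 1) x y = 0) → x = 0)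
    (hRirr : Irreducible (R.map (Int.castRingHom ℚ)))
    (hψR : Polynomial.eval₂ (Int.castRingHom (CategoryTheory.End A)) (ψ : CategoryTheory.End A) R = 0)
    (hsym : ∀ x y : complexBetti A.X 1, polarizationPairingOne A.X h (A.dim - 1) (pullbackOne A ψ x) y =
      polarizationPairingOne A.X h (A.dim - 1) x (pullbackOne A ψ y))
    (hZ : ∀ g : A ⟶ A, (∀ χ : A ⟶ A, g ≫ χ = χ ≫ g) →
      ∃ N : ℤ, N ≠ 0 ∧ End.of (N • g) ∈ Subring.closure {End.of ψ}) :
    (∀ z ∈ Subgroup.center (divisorLefschetzGroup (⨁ (fun _ : Fin (n + 2) => A))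
        (sumPolarizationClass (fun _ : Fin (n + 2) => A) fun _ => h)), z * z = 1) ∧
      Finite (Subgroup.center (divisorLefschetzGroup (⨁ (fun _ : Fin (n + 2) => A))
        (sumPolarizationClass (fun _ : Fin (n + 2) => A) fun _ => h))) ∧
      Nat.card (Subgroup.center (divisorLefschetzGroup (⨁ (fun _ : Fin (n + 2) => A))
        (sumPolarizationClass (fun _ : Fin (n + 2) => A) fun _ => h))) ≤ 2 ^ R.natDegree := by
  obtain ⟨hhX, -, hndX⟩ := sumPolarizationClass_hypotheses (fun _ : Fin (n + 2) => A) (fun _ => h) (fun _ => hA)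
    (fun _ => hh) (fun _ => htop) (fun _ => hnd)
  have hsymX := fun x y ↦ polarizationPairingOne_biproductMap_of_adjoint (fun _ : Fin (n + 2) => A) (fun _ => h)
    (fun _ => hA) (fun _ => ψ) (fun _ => ψ) (fun _ => hsym) x y
  -- «m ≥ 2 ⟹ B ⊗ ℂ = End⁰ ⊗ ℂ» on `⨁_{Fin (n+2)} A ∼ A.powSucc (n+1)`
  have hB := pullbackOne_mem_adjoin_symmetricPullbackSpan_of_isIsogenous_powSucc hA hh hnd htop
    (isIsogenous_biproduct_powSucc A (n + 1)) hhX hndX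
  exact finite_center_divisorLefschetzGroup_of_forall_mem_adjoin_of_symm hhX hndX hRirr
    (eval₂_biproductMap_const_eq_zero hψR) hsymX (forall_central_exists_zsmul_mem_closure_biproduct hZ) hB

/-- **MOONEN–ZARHIN LEMMA (1), «… IN ALL OTHER CASES IT IS FINITE», `m ≥ 2`, IN THE PRINT'S STANDING GENERALITY,
`ℂ`-POINTS**: for EVERY complex abelian variety `X` ISOGENOUS TO A POWER `A^{n+2}` of an abelian variety whose
endomorphism algebra has TOTALLY REAL centre in the `End(A)`-level sense (`ψ` Rosati-symmetric for some admissible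
`h` with `h^{dim A} ≠ 0`, `R(ψ) = 0` irreducible, `Z(End⁰ A) ⊆ ℚ(ψ)`) and EVERY admissible class `h_X`
on `X`: every central element of `G_div(X)(h_X)(ℂ)` is an involution, and the centre is finite of order `≤ 2^{deg R}`
(`U_{K_B}(ℂ) = μ₂^{[K_B:ℚ]}`, `K_B = E = ℚ(ψ)`).  No hypothesis on `B(A)` or `d`; simplicity of `A` is not used.
[cite: MoonenZarhin1998WeilClasses, §1 Lemma (1) (chunk p0002 L121–L127) with chunk p0002 L45–L48, L83–L85, L96–L97]
[cite: Milne1999LefschetzClasses, §1 pp. 643–644, §2 pp. 645–650] -/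
theorem center_divisorLefschetzGroup_involutive_finite_card_le_of_isIsogenous_biproduct_two_of_symm
    (hA : 0 < A.dim) (hh : h ∈ hodgeClassSpan A.dim A.X 1) (htop : lefschetzPow h (A.dim - 1) 2 h ≠ 0)
    (hnd : ∀ x : complexBetti A.X 1, (∀ y, polarizationPairingOne A.X h (A.dim - 1) x y = 0) → x = 0)
    (hRirr : Irreducible (R.map (Int.castRingHom ℚ)))
    (hψR : Polynomial.eval₂ (Int.castRingHom (CategoryTheory.End A)) (ψ : CategoryTheory.End A) R = 0)
    (hsym : ∀ x y : complexBetti A.X 1, polarizationPairingOne A.X h (A.dim - 1) (pullbackOne A ψ x) y =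
      polarizationPairingOne A.X h (A.dim - 1) x (pullbackOne A ψ y))
    (hZ : ∀ g : A ⟶ A, (∀ χ : A ⟶ A, g ≫ χ = χ ≫ g) →
      ∃ N : ℤ, N ≠ 0 ∧ End.of (N • g) ∈ Subring.closure {End.of ψ})
    {X : AbelianVariety ℂ} (hX : AbelianVariety.IsIsogenous X (⨁ (fun _ : Fin (n + 2) => A)))
    {hX' : complexBetti X.X 2} (hhX : hX' ∈ hodgeClassSpan X.dim X.X 1)
    (hndX : ∀ x : complexBetti X.X 1, (∀ y, polarizationPairingOne X.X hX' (X.dim - 1) x y = 0) → x = 0) :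
    (∀ z ∈ Subgroup.center (divisorLefschetzGroup X hX'), z * z = 1) ∧
      Finite (Subgroup.center (divisorLefschetzGroup X hX')) ∧
      Nat.card (Subgroup.center (divisorLefschetzGroup X hX')) ≤ 2 ^ R.natDegree := by
  obtain ⟨hhP, -, hndP⟩ := sumPolarizationClass_hypotheses (fun _ : Fin (n + 2) => A) (fun _ => h) (fun _ => hA)
    (fun _ => hh) (fun _ => htop) (fun _ => hnd)
  exact center_divisorLefschetzGroup_involutive_finite_card_le_of_isIsogenous hX hhX hndX hhP hndP
    (center_divisorLefschetzGroup_biproduct_two_involutive_finite_card_le_of_symm hA hh htop hnd hRirr hψR hsym hZ)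

end FiniteHalf

/-! ### §5 The dichotomy of Lemma (1) for `m ≥ 2`, read on `End(A)`: infinite centre iff the Rosati involution moves `ψ` -/

section Dichotomy

variable {A : AbelianVariety ℂ} {h : complexBetti A.X 2} {n : ℕ} {ψ ψ' : A ⟶ A} {R : Polynomial ℤ}

/-- **MOONEN–ZARHIN LEMMA (1), SECOND SENTENCE, AS A DICHOTOMY FOR `X ∼ A^{n+2}` READ ON `End(A)`**: let the centre of
`End⁰(A)` be `ℚ(ψ)` (`ψ` central, `R(ψ) = 0` with `R` monic irreducible over `ℚ`, every central `g` with `N g ∈ ℤ[ψ]`)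
and let `ψ'` be the Rosati image of `ψ` for an admissible `h` (`Q_h(ψ^* x, y) = Q_h(x, ψ'^* y)`, `N'ψ' ∈ ℤ[ψ]`).  Then
for every `X` isogenous to `A^{n+2}` and every admissible `h_X`: `Z(G_div(X)(h_X))(ℂ)` IS INFINITE IFF `ψ' ≠ ψ` — type 4
(`E` CM, `†` = complex conjugation on `E`): the torus `(ℂ^×)^{e₀}` of §3; «all other cases» (`E` totally real, `†`
trivial on `E`): the finite `2`-group of §4.
[cite: MoonenZarhin1998WeilClasses, §1 Lemma (1) (chunk p0002 L121–L127 «For X of type 4 with either d ≥ 2 or m ≥ 2 this is a connected torus of rank e₀; in all other cases it is finite»)]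
[cite: Milne1999LefschetzClasses, §2 pp. 645–651] -/
theorem infinite_center_divisorLefschetzGroup_iff_ne_of_isIsogenous_biproduct_two
    (hA : 0 < A.dim) (hh : h ∈ hodgeClassSpan A.dim A.X 1) (htop : lefschetzPow h (A.dim - 1) 2 h ≠ 0)
    (hnd : ∀ x : complexBetti A.X 1, (∀ y, polarizationPairingOne A.X h (A.dim - 1) x y = 0) → x = 0)
    (hψ : ∀ χ : A ⟶ A, ψ ≫ χ = χ ≫ ψ) (hRm : R.Monic) (hRirr : Irreducible (R.map (Int.castRingHom ℚ)))
    (hψR : Polynomial.eval₂ (Int.castRingHom (CategoryTheory.End A)) (ψ : CategoryTheory.End A) R = 0)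
    (hadj : ∀ x y : complexBetti A.X 1, polarizationPairingOne A.X h (A.dim - 1) (pullbackOne A ψ x) y =
      polarizationPairingOne A.X h (A.dim - 1) x (pullbackOne A ψ' y))
    (hψ'E : ∃ N : ℤ, N ≠ 0 ∧ End.of (N • ψ') ∈ Subring.closure {End.of ψ})
    (hZ : ∀ g : A ⟶ A, (∀ χ : A ⟶ A, g ≫ χ = χ ≫ g) →
      ∃ N : ℤ, N ≠ 0 ∧ End.of (N • g) ∈ Subring.closure {End.of ψ})
    {X : AbelianVariety ℂ} (hX : AbelianVariety.IsIsogenous X (⨁ (fun _ : Fin (n + 2) => A)))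
    {hX' : complexBetti X.X 2} (hhX : hX' ∈ hodgeClassSpan X.dim X.X 1)
    (hndX : ∀ x : complexBetti X.X 1, (∀ y, polarizationPairingOne X.X hX' (X.dim - 1) x y = 0) → x = 0) :
    Infinite (Subgroup.center (divisorLefschetzGroup X hX')) ↔ ψ' ≠ ψ := by
  constructor
  · intro hinf heq
    subst heq
    obtain ⟨-, hfin, -⟩ :=
      center_divisorLefschetzGroup_involutive_finite_card_le_of_isIsogenous_biproduct_two_of_symm hA hh htop hnd hRirr
        hψR hadj hZ hX hhX hndX
    exact not_finite (Subgroup.center (divisorLefschetzGroup X hX'))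
  · intro hne
    exact infinite_center_divisorLefschetzGroup_of_isIsogenous_biproduct_two_of_CMCentre_End hA hh htop hnd hψ hRm hRirr
      hψR hadj hψ'E hne hZ hX hhX hndX

/-- **… equivalently: `Z(G_div(X)(h_X))(ℂ)` IS FINITE IFF `ψ' = ψ`** (the Rosati involution is trivial on the centre
`ℚ(ψ)` of `End⁰(A)`), for every `X ∼ A^{n+2}` and every admissible `h_X`.
[cite: MoonenZarhin1998WeilClasses, §1 Lemma (1) (chunk p0002 L121–L127)] -/
theorem finite_center_divisorLefschetzGroup_iff_eq_of_isIsogenous_biproduct_two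
    (hA : 0 < A.dim) (hh : h ∈ hodgeClassSpan A.dim A.X 1) (htop : lefschetzPow h (A.dim - 1) 2 h ≠ 0)
    (hnd : ∀ x : complexBetti A.X 1, (∀ y, polarizationPairingOne A.X h (A.dim - 1) x y = 0) → x = 0)
    (hψ : ∀ χ : A ⟶ A, ψ ≫ χ = χ ≫ ψ) (hRm : R.Monic) (hRirr : Irreducible (R.map (Int.castRingHom ℚ)))
    (hψR : Polynomial.eval₂ (Int.castRingHom (CategoryTheory.End A)) (ψ : CategoryTheory.End A) R = 0)
    (hadj : ∀ x y : complexBetti A.X 1, polarizationPairingOne A.X h (A.dim - 1) (pullbackOne A ψ x) y =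
      polarizationPairingOne A.X h (A.dim - 1) x (pullbackOne A ψ' y))
    (hψ'E : ∃ N : ℤ, N ≠ 0 ∧ End.of (N • ψ') ∈ Subring.closure {End.of ψ})
    (hZ : ∀ g : A ⟶ A, (∀ χ : A ⟶ A, g ≫ χ = χ ≫ g) →
      ∃ N : ℤ, N ≠ 0 ∧ End.of (N • g) ∈ Subring.closure {End.of ψ})
    {X : AbelianVariety ℂ} (hX : AbelianVariety.IsIsogenous X (⨁ (fun _ : Fin (n + 2) => A)))
    {hX' : complexBetti X.X 2} (hhX : hX' ∈ hodgeClassSpan X.dim X.X 1)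
    (hndX : ∀ x : complexBetti X.X 1, (∀ y, polarizationPairingOne X.X hX' (X.dim - 1) x y = 0) → x = 0) :
    Finite (Subgroup.center (divisorLefschetzGroup X hX')) ↔ ψ' = ψ := by
  rw [← not_infinite_iff_finite,
    infinite_center_divisorLefschetzGroup_iff_ne_of_isIsogenous_biproduct_two hA hh htop hnd hψ hRm hRirr hψR hadj
      hψ'E hZ hX hhX hndX, not_ne_iff]

end Dichotomy

end Literature.AlgebraicGeometry.HodgeTheory

end
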